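import Literature.AlgebraicGeometry.RealAlgebraic.RealAlgebraicCharts
import Literature.AlgebraicGeometry.RealAlgebraic.RealAlgebraicCoordinates
import Literature.AlgebraicGeometry.RealAlgebraic.RealAbelJacobi
import HarnessLib

/-!
# Real points of a smooth proper scheme are a submanifold of the coordinate space

Let `k ⊆ ℝ` be a field, `X` a `k`-scheme proper over `k` and smooth of relative dimension `d`,
and `f₁, …, f_N ∈ Γ(X, V)` an algebraic coordinate system on the real points
(`Literature.AlgebraicGeometry.RealAlgebraic.IsAlgCoordSystem`, file
`RealAlgebraic/RealAlgebraicCoordinates`), so that `Q ↦ (f_j(Q))_j` is a closed embedding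
`X(ℝ) ↪ ℝ^N` (`IsAlgCoordSystem.isClosedEmbedding`). This file proves that the image
`S = f(X(ℝ)) ⊆ ℝ^N` is a `d`-dimensional embedded `C^∞` submanifold in the elementary sense
`Literature.AlgebraicGeometry.RealAlgebraic.IsSubmanifoldOfDim` of `RealAlgebraic/RealAbelJacobi`
(local `C^∞` parametrisations of `S` by the unit ball of `ℝᵈ` admitting `C^∞` left inverses on
open sets of `ℝ^N`): `IsAlgCoordSystem.isSubmanifoldOfDim_range`.

Proof. At a real point `P`, take the real-analytic algebraic chart `e : X(ℝ) → ℝᵈ` of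
`RealAlgebraic/RealAlgebraicCharts` (`exists_analyticAlgebraicChart`: coordinates regular
functions `x₁, …, x_d`, regular functions analytic in the chart). The parametrisation is
`φ = f ∘ e⁻¹` (analytic: the `f_j` are regular), rescaled from a small ball to the unit ball; the
left inverse is `ψ = (x_i as analytic functions of the coordinates)` near `f(P)`
(`IsAlgCoordSystem.exists_analyticOnNhd_eval`: regular functions are locally analytic functions of
the coordinates), and `φ(ball) = S ∩ U` for a suitable open `U` because `f` is an embedding. This
is the classical statement that the real points of a nonsingular variety over `k ⊆ ℝ` form a
real-analytic (Nash) submanifold of the ambient affine space of dimension `d` at every point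
(Bochnak–Coste–Roy, *Real Algebraic Geometry*, Prop. 3.3.11; Akbulut–King, *Topology of Real
Algebraic Sets*, II §3), here for the affine embedding of projective real points (Akbulut–King II
Prop. 2.4.1). It supplies the fields `isSubmanifold_pts` (`J(ℝ)`, `d = dim J`) and
`isSubmanifold_C` (`C(ℝ)`, `d = 1`) of the real Abel–Jacobi package
(`RealAbelJacobi.exists_realization`). No named fact is introduced.

## References

* J. Bochnak, M. Coste, M.-F. Roy, *Real Algebraic Geometry* (1998), Prop. 3.3.11.
  [BochnakCosteRoy1998]
* S. Akbulut, H. King, *Topology of Real Algebraic Sets*, MSRI Publ. 25 (1992), Ch. II §3 and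
  Prop. 2.4.1. [AkbulutKing1992]
-/

noncomputable section

open CategoryTheory AlgebraicGeometry Set Metric
open _root_.Topology
open scoped ContDiff

namespace Literature.AlgebraicGeometry.RealAlgebraic

open Literature.AlgebraicGeometry.Motives Literature.NumberTheory.Transcendental

variable {k : Type} [Field k] [Algebra k ℝ] {X : SchemeOver k} {N : ℕ} {V : X.left.Opens}
  {f : Fin N → Γ(X.left, V)}

/-- **The real points of a smooth proper scheme form a submanifold of the coordinate space.**
For `X` proper over `k ⊆ ℝ` and smooth of relative dimension `d`, and an algebraic coordinate
system `f` on `X(ℝ)`, the image `f(X(ℝ)) ⊆ ℝ^N` is a `d`-dimensional embedded `C^∞` submanifold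
(`IsSubmanifoldOfDim`): near `f(P)` it is parametrised by `f ∘ e⁻¹` for a real-analytic algebraic
chart `e` of `X(ℝ)` at `P`, with left inverse the chart coordinates read as analytic functions of
the ambient coordinates. (Bochnak–Coste–Roy Prop. 3.3.11: nonsingular real points form an
analytic submanifold of dimension `d`; Akbulut–King II §3, Prop. 2.4.1 for projective sets made
affine.) [cite: BochnakCosteRoy1998, Prop. 3.3.11] [cite: AkbulutKing1992, Ch. II §3 and Prop. 2.4.1] -/
theorem IsAlgCoordSystem.isSubmanifoldOfDim_range (d : ℕ) [SmoothOfRelativeDimension d X.hom]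
    [IsProper X.hom] (hc : IsAlgCoordSystem ℝ V f) :
    IsSubmanifoldOfDim d (range (coordMap ℝ V f)) := by
  classical
  rintro _ ⟨P, rfl⟩
  set y := coordMap ℝ V f with hy
  have hemb : IsClosedEmbedding y := hc.isClosedEmbedding
  -- the analytic algebraic chart at `P`
  obtain ⟨e, hPe, ⟨Ue, x, hsrc, hex⟩, han⟩ := exists_analyticAlgebraicChart (𝕜 := ℝ) X d P
  -- Step 1: `φ₀ = y ∘ e⁻¹` is analytic near `e P`
  obtain ⟨Ua, hUa, hPUa, hUaV⟩ :=
    exists_isAffineOpen_mem_and_subset (X := X.left) (U := V) (hc.pt_mem P)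
  have hUaV' : Ua ≤ V := hUaV
  set T₁ : Set (Fin d → ℝ) := e.target ∩ e.symm ⁻¹' {Q | Q.pt ∈ Ua} with hT₁
  have hT₁o : IsOpen T₁ := e.isOpen_inter_preimage_symm (AlgPoints.isOpen_setOf_pt_mem Ua)
  have hPT₁ : e P ∈ T₁ := by
    refine ⟨e.map_source hPe, ?_⟩
    change (e.symm (e P)).pt ∈ Ua
    rw [e.left_inv hPe]
    exact hPUa
  set φ₀ : (Fin d → ℝ) → (Fin N → ℝ) := fun w => y (e.symm w) with hφ₀
  have hφ₀an : AnalyticOnNhd ℝ φ₀ T₁ := by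
    change AnalyticOnNhd ℝ (fun w j => φ₀ w j) T₁
    refine AnalyticOnNhd.pi fun j => ?_
    refine (han ⟨Ua, hUa⟩ (X.left.presheaf.map (homOfLE hUaV').op (f j))).congr hT₁o ?_
    intro w hw
    simp only [Function.comp_apply, hφ₀, hy, coordMap_apply]
    exact AlgPoints.evalOrZero_map_homOfLE hUaV' (f j) hw.2
  -- Step 2: the chart coordinates are analytic functions `ψ₀` of the ambient coordinates
  have hPUe : P.pt ∈ (Ue : X.left.Opens) := hsrc hPe
  have key := fun i => hc.exists_analyticOnNhd_eval (U := (Ue : X.left.Opens)) (x i) hPUe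
  choose O G hOo _hOsa hPO hGan hGval using key
  set O' : Set (Fin N → ℝ) := ⋂ i, O i with hO'
  have hO'o : IsOpen O' := isOpen_iInter_of_finite hOo
  have hPO' : y P ∈ O' := mem_iInter.mpr hPO
  set ψ₀ : (Fin N → ℝ) → (Fin d → ℝ) := fun v i => G i v with hψ₀
  have hψ₀an : AnalyticOnNhd ℝ ψ₀ O' :=
    AnalyticOnNhd.pi fun i => (hGan i).mono (iInter_subset _ i)
  have hψ₀φ₀ : ∀ Q ∈ e.source, y Q ∈ O' → ψ₀ (y Q) = e Q := by
    intro Q hQ hQO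
    funext i
    obtain ⟨hQUe, hval⟩ := hGval i Q (mem_iInter.mp hQO i)
    rw [hex Q hQ i, AlgPoints.evalOrZero_of_mem _ hQUe]
    exact hval.symm
  -- Step 3: a ball around `e P` on which everything is defined
  set T₂ : Set (Fin d → ℝ) := T₁ ∩ φ₀ ⁻¹' O' with hT₂
  have hT₂o : IsOpen T₂ := hφ₀an.continuousOn.isOpen_inter_preimage hT₁o hO'o
  have hPT₂ : e P ∈ T₂ := by
    refine ⟨hPT₁, ?_⟩
    change y (e.symm (e P)) ∈ O'
    rw [e.left_inv hPe]
    exact hPO'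
  obtain ⟨ε, hε, hball⟩ := Metric.isOpen_iff.mp hT₂o (e P) hPT₂
  -- Step 4: the open set `U₁` of `ℝ^N` cutting out the image of the chart domain over the ball
  set B : Set (Fin d → ℝ) := ball (e P) ε with hB
  set A : Set (AlgPoints X ℝ) := e.source ∩ e ⁻¹' B with hA
  have hAo : IsOpen A := e.isOpen_inter_preimage isOpen_ball
  obtain ⟨U₁, hU₁o, hU₁A⟩ := hemb.isInducing.isOpen_iff.mp hAo
  have hSU₁ : range y ∩ U₁ = y '' A := by
    rw [← hU₁A, image_preimage_eq_range_inter]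
  -- affine rescaling of the unit ball onto `B`
  have haff : ∀ t : Fin d → ℝ, t ∈ ball (0 : Fin d → ℝ) 1 → e P + ε • t ∈ B := by
    intro t ht
    rw [mem_ball_zero_iff] at ht
    rw [hB, mem_ball, dist_eq_norm, add_sub_cancel_left, norm_smul, Real.norm_eq_abs,
      abs_of_pos hε]
    calc ε * ‖t‖ < ε * 1 := mul_lt_mul_of_pos_left ht hε
      _ = ε := mul_one ε
  set φ : (Fin d → ℝ) → (Fin N → ℝ) := fun t => φ₀ (e P + ε • t) with hφ
  set ψ : (Fin N → ℝ) → (Fin d → ℝ) := fun v => ε⁻¹ • (ψ₀ v - e P) with hψ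
  have hψφ : ∀ t ∈ ball (0 : Fin d → ℝ) 1, ψ (φ t) = t := by
    intro t ht
    have hw : e P + ε • t ∈ T₂ := hball (haff t ht)
    have hsrc' : e.symm (e P + ε • t) ∈ e.source := e.map_target hw.1.1
    have hO'' : y (e.symm (e P + ε • t)) ∈ O' := hw.2
    simp only [hψ, hφ, hφ₀]
    rw [hψ₀φ₀ _ hsrc' hO'', e.right_inv hw.1.1, add_sub_cancel_left, smul_smul,
      inv_mul_cancel₀ hε.ne', one_smul]
  refine ⟨O' ∩ U₁, φ, ψ, hO'o.inter hU₁o, ⟨hPO', ?_⟩, ?_, ?_, hψφ, ?_⟩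
  · -- `y P ∈ U₁`
    have h : y P ∈ y '' A := ⟨P, ⟨hPe, mem_ball_self hε⟩, rfl⟩
    rw [← hSU₁] at h
    exact h.2
  · -- `φ` is `C^∞` on the unit ball
    have h1 : ContDiffOn ℝ ∞ φ₀ T₁ := hφ₀an.contDiffOn_of_completeSpace
    have h2 : ContDiff ℝ ∞ fun t : Fin d → ℝ => e P + ε • t :=
      contDiff_const.add (contDiff_const_smul ε)
    exact h1.comp h2.contDiffOn fun t ht => (hball (haff t ht)).1
  · -- `ψ` is `C^∞` on `U`
    have h1 : ContDiffOn ℝ ∞ ψ₀ O' := hψ₀an.contDiffOn_of_completeSpace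
    exact ((h1.sub contDiffOn_const).const_smul ε⁻¹).mono inter_subset_left
  · -- `φ(ball) = S ∩ U`
    ext v
    constructor
    · rintro ⟨t, ht, rfl⟩
      have hw : e P + ε • t ∈ T₂ := hball (haff t ht)
      have hsrc' : e.symm (e P + ε • t) ∈ e.source := e.map_target hw.1.1
      refine ⟨⟨e.symm (e P + ε • t), rfl⟩, hw.2, ?_⟩
      have hmemA : e.symm (e P + ε • t) ∈ A := by
        refine ⟨hsrc', ?_⟩
        change e (e.symm (e P + ε • t)) ∈ B
        rw [e.right_inv hw.1.1]
        exact haff t ht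
      have h : y (e.symm (e P + ε • t)) ∈ y '' A := ⟨_, hmemA, rfl⟩
      rw [← hSU₁] at h
      exact h.2
    · rintro ⟨hvS, hvO', hvU₁⟩
      have h : v ∈ y '' A := by
        rw [← hSU₁]
        exact ⟨hvS, hvU₁⟩
      obtain ⟨Q, ⟨hQsrc, hQB⟩, rfl⟩ := h
      have hQB' : e Q ∈ B := hQB
      refine ⟨ε⁻¹ • (e Q - e P), ?_, ?_⟩
      · rw [mem_ball_zero_iff, norm_smul, norm_inv, Real.norm_eq_abs, abs_of_pos hε]
        rw [hB, mem_ball, dist_eq_norm] at hQB'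
        calc ε⁻¹ * ‖e Q - e P‖ < ε⁻¹ * ε := mul_lt_mul_of_pos_left hQB' (inv_pos.mpr hε)
          _ = 1 := inv_mul_cancel₀ hε.ne'
      · simp only [hφ, hφ₀]
        rw [smul_smul, mul_inv_cancel₀ hε.ne', one_smul, add_sub_cancel, e.left_inv hQsrc]

end Literature.AlgebraicGeometry.RealAlgebraic

end
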